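import Literature.MathematicalPhysics.QuantumFieldTheory.Balaban1983to89.Beta.KernelSpecInstance

/-!
# The FLUCTUATION COVARIANCE KERNEL `Γ_N` of the typed `U = 1` block-averaging KKT system on `ℤ^{d+1}` — columns of the
Bloch-fibre fundamental solution with EL-row (force) sources

Literature / mathematical physics / constructive QFT / Bałaban 1983–89, β-function sub-cell (row BETA-an2, background-
field route), located item **(D1-read)** of the scale-wise (D1) programme (cell RULING (R16-2)/(R16-3), BETA-SPEC §7.31 (e);
AN2.md §12.2 (v)/§13): the first typed brick of the genuine one-step one-loop Hessian kernels `T_j` — the propagator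
they are built from.

HONEST FRAMING.  Discharging `BetaPertH` makes Bałaban's UV stability UNCONDITIONAL — a real constructive-QFT result;
it is NOT the continuum limit and NOT the Clay problem.  This file is `[folklore]` linear algebra and elementary
analysis; it cites nothing and asserts nothing about Bałaban's papers (ABSOLUTE RULE of the cell: zero cited facts
here; every `theorem` below is kernel-checked).  Its value is a typed, decaying KERNEL OBJECT for the cell's own
system; it is NOT summit progress.

WHAT IS CONSTRUCTED (all objects from the imports; `N` = the block side, `d + 1` = the dimension).
`Beta/BlochFibreMatrix` solves the box-of-origin block system of the typed KKT problem for an ARBITRARY source vector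
`e` on the rows of block `0` (`fundCfg e`, `cfgFun_fundCfg`: residual `δ_{y,0} e` on block `y`, ALL rows), and
`Beta/KernelSpecInstance` used the sources on the Q rows (constraint data) to build the solution operator `H`.  Here the
source sits on an EULER–LAGRANGE row `(l, z₀)` — a unit FORCE on the fine bond `(l, repZ z₀)` of block `0`
(`srcEL l z₀`).  Reading the residual back on `ℤ^{d+1}` (§2, `fundCfg_EL/_G/_M/_Q`, no vanishing hypothesis on `e`):
the fine field `A = gcolA l z₀`, the coarse constraint multiplier `φ = gcolφ l z₀` and the gauge multiplier
`μ = gcolμ l z₀` of `fundCfg (srcEL l z₀)` satisfy (§3)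
  (EL)  `d*d A − 𝒬ᵀ φ − d δ d μ = δ_{(l, repZ z₀)}`      (unit force at the source bond, zero elsewhere),
  (G)   `δ d δ A` is block-constant                        (the weak = range-form gauge condition),
  (M)   `blockSum N μ = 0`                                 (normalisation of the gauge multiplier),
  (Q)   `𝒬 A = contourSum N A = 0`                         (the FLUCTUATION constraint: zero block averages);
i.e. `A` is the column, at the source bond, of the constrained, gauge-fixed Green's function of the bare quadratic form
— the KKT point of `A ↦ ½|curv A|² − ⟨f, A⟩` on `{𝒬A = 0, gauge}` with `f` the unit force.  §4: the REAL kernels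
`wΓ l z₀ := Re A`, `wΓφ`, `wΓμ` satisfy the same four identities over `ℝ` (`wΓ_EL`, `wΓ_G`, `wΓμ_M`, `wΓ_Q`); §5: they
DECAY exponentially from the origin AT FIXED `N` (`decay_wΓ/…`: witnesses `δ_N = δ/N`, `C_N = M e^{δ(d+1)}` from
`invKernel_fibre_decay_l1 (N := N)`, uniformly in the source `(l, z₀)`; existential PER `N`, no uniformity in `N`
claimed) and have absolutely summable second moments; §6: the kernel with an ARBITRARY source bond `(l, x')`,
`Gam κ x l x' := wΓ l (proj x') κ (x − N • quo x')` (block translation covariance taken as the DEFINITION), satisfies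
(EL) with `δ_{(l, x')}`, (G), (M), (Q) (`Gam_EL`, `Gam_G`, `GamM_M`, `Gam_Q`) and decays in `|x − x'|₁` (`decay_Gam`).
No sorry, no new axioms, no cited facts.  NOT proved here (located, AN2.md §13): symmetry `Γ(b, b') = Γ(b', b)` and
uniqueness of the decaying solution (tempered uniqueness is `Beta/BlochFibreUniqueness`' business), any closed formula.

READING (markdown only, never cited; AN2.md §13, DIVERGENCE D-an2.13).  In print the corresponding object at `U = 1` is
the fluctuation covariance of the Gaussian measure with the sharp constraints `QA = 0`, `R∂*A = 0`:
[Balaban1984PropagatorsI] p. 17 «they define propagators, i.e. covariances of the Gaussian measure», p. 34–35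
(1.104)–(1.107) (the `Δ_a`-orthogonal projection `P = I − G∂R∂* − GQ*(QGQ*)⁻¹Q` onto `{QA = 0, R∂*A = 0}`), and
[Balaban1985BackgroundPropagators] p. 425–426 (3.148)–(3.153) («an operator 𝒢 defined as a covariance of the Gaussian
integral … 𝒢 = G₁ − G₁DRD*G₁ − G₁Q*(QG₁Q*)⁻¹QG₁ = G₁𝒫»).  The typed object differs by the cell's normalisations
(`curvAdj ∘ curv = 2∂*∂`, `contourSum N = N^{d+1}·Q`, ordered direction pairs) and by its carrier (`ℤ^{d+1}` and Bloch
fibres instead of a torus / Dirichlet domain and positivity) — a dictionary, not an identity proved here.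
-/

namespace Literature.MathematicalPhysics.QuantumFieldTheory.Balaban1983to89.Beta.KKTFluctuationKernel

noncomputable section

open Literature.Probability.LatticeModels (TorusSite Torus.proj Torus.proj_apply)
open AffineAveraging (Form0 Form1 Form2 unitVec unitVec_apply dz curv curvAdj codiff₁ box toSite blockSum
  contourSum)
open AffineReproduction (contourSumAdj IsBlockConst)
open LatticeForm (repZ quo proj_repZ)
open BlochFibreUniqueness (adjContourSum adjContourSum_apply quo_add_zsmul quo_repZ)
open BlochFibreMatrix (Idx Cfg cfgA cfgμ cfgφ shiftCfg stencil pieceMatrix fundCfg cfgFun_fundCfg repZ_nonneg repZ_lt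
  eq_repZ_add_zsmul_quo toSite_eq_repZ_proj invKernel_fibre_decay_l1 cfgFun_shiftCfg_inl cfgFun_shiftCfg_inr_inl
  cfgFun_shiftCfg_inr_inr repZ_zero)
open FibreInverseDecay (invKernel)
open KernelSpecInstance (re0 re1 re2 re0_apply re1_apply re2_apply re1_dz re2_curv re1_curvAdj re0_codiff₁
  re1_contourSum re1_adjContourSum l1_le_l1_quo exp_quo_le opEL_shift opG_shift opM_shift contourSum_shift
  contourSumAdj_shift)
open DecimatedMomentSummable (AbsMoment₂ absMoment₂_of_decay510)
open B12Sec2to5 (l1 Decay510)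

variable {d N : ℕ}

/-! ## §1 Force sources on the Euler–Lagrange rows -/

section Sources

/-- The unit FORCE source in the EL row `(l, z₀)`: a unit force on the fine bond `(l, repZ z₀)` of block `0`, nothing on
the G/M/Q rows. [folklore] -/
def srcEL (l : Fin (d + 1)) (z₀ : TorusSite (d + 1) N) : Idx (d + 1) N → ℂ :=
  fun i => if i = Sum.inl (l, z₀) then 1 else 0

/-- The force source on the EL rows. [folklore] -/
@[simp] theorem srcEL_inl (l κ : Fin (d + 1)) (z₀ z : TorusSite (d + 1) N) :
    srcEL (N := N) l z₀ (Sum.inl (κ, z)) = if κ = l ∧ z = z₀ then 1 else 0 := by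
  simp [srcEL, Prod.ext_iff]

/-- The force source vanishes on the G/M rows. [folklore] -/
@[simp] theorem srcEL_inr_inl (l : Fin (d + 1)) (z₀ z : TorusSite (d + 1) N) :
    srcEL (N := N) l z₀ (Sum.inr (Sum.inl z)) = 0 := by
  simp [srcEL]

/-- The force source vanishes on the Q rows. [folklore] -/
@[simp] theorem srcEL_inr_inr (l κ : Fin (d + 1)) (z₀ : TorusSite (d + 1) N) :
    srcEL (N := N) l z₀ (Sum.inr (Sum.inr κ)) = 0 := by
  simp [srcEL]

variable [NeZero N]

/-- A matrix applied to the force source reads off one column. [folklore] -/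
theorem mulVec_srcEL (K : Matrix (Idx (d + 1) N) (Idx (d + 1) N) ℂ) (l : Fin (d + 1)) (z₀ : TorusSite (d + 1) N)
    (i : Idx (d + 1) N) : K.mulVec (srcEL l z₀) i = K i (Sum.inl (l, z₀)) := by
  simp [Matrix.mulVec, dotProduct, srcEL]

end Sources

/-! ## §2 The residual of the fundamental configuration read back on `ℤ^{d+1}`, for an ARBITRARY source -/

section Readback

variable [NeZero N]

/-- EL rows: the Euler–Lagrange residual of `fundCfg e` at the fine point `x` is the EL-row entry of `e` if `x` lies in
block `0`, and `0` otherwise. [folklore] -/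
theorem fundCfg_EL (e : Idx (d + 1) N → ℂ) (κ : Fin (d + 1)) (x : AffineAveraging.Site (d + 1)) :
    curvAdj (curv (cfgA (fundCfg (N := N) e))) κ x - adjContourSum N (cfgφ (fundCfg (N := N) e)) κ x
        - dz (codiff₁ (dz (cfgμ (fundCfg (N := N) e)))) κ x
      = if quo N x = 0 then e (Sum.inl (κ, Torus.proj N x)) else 0 := by
  have hx : x = repZ (Torus.proj N x) + (N : ℤ) • quo N x := eq_repZ_add_zsmul_quo x
  have h := congr_fun (cfgFun_fundCfg (N := N) e (quo N x)) (Sum.inl (κ, Torus.proj N x))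
  rw [cfgFun_shiftCfg_inl, ← hx] at h
  rw [h]
  split_ifs <;> rfl

/-- G rows: the gauge quantity of `fundCfg e` at `repZ z + N • y` minus its value at the block corner `N • y` is the
G-row entry of `e` on block `0` (for `z ≠ 0`), and `0` on every other block. [folklore] -/
theorem fundCfg_G (e : Idx (d + 1) N → ℂ) (y : AffineAveraging.Site (d + 1)) {z : TorusSite (d + 1) N} (hz : z ≠ 0) :
    codiff₁ (dz (codiff₁ (cfgA (fundCfg (N := N) e)))) (repZ z + (N : ℤ) • y)
        - codiff₁ (dz (codiff₁ (cfgA (fundCfg (N := N) e)))) ((N : ℤ) • y)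
      = if y = 0 then e (Sum.inr (Sum.inl z)) else 0 := by
  have h := congr_fun (cfgFun_fundCfg (N := N) e y) (Sum.inr (Sum.inl z))
  rw [cfgFun_shiftCfg_inr_inl, if_neg hz] at h
  rw [h]
  split_ifs <;> rfl

/-- M row: the block sum of the gauge multiplier of `fundCfg e` over block `y` is the M-row entry of `e` for `y = 0`,
and `0` otherwise. [folklore] -/
theorem fundCfg_M (e : Idx (d + 1) N → ℂ) (y : AffineAveraging.Site (d + 1)) :
    blockSum N (cfgμ (fundCfg (N := N) e)) y = if y = 0 then e (Sum.inr (Sum.inl 0)) else 0 := by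
  have h := congr_fun (cfgFun_fundCfg (N := N) e y) (Sum.inr (Sum.inl 0))
  rw [cfgFun_shiftCfg_inr_inl, if_pos rfl] at h
  rw [h]
  split_ifs <;> rfl

/-- Q rows: the block averages of the fine field of `fundCfg e` are the Q-row entries of `e` on block `0`, and `0` on
every other block. [folklore] -/
theorem fundCfg_Q (e : Idx (d + 1) N → ℂ) (κ : Fin (d + 1)) (y : AffineAveraging.Site (d + 1)) :
    contourSum N (cfgA (fundCfg (N := N) e)) κ y = if y = 0 then e (Sum.inr (Sum.inr κ)) else 0 := by
  have h := congr_fun (cfgFun_fundCfg (N := N) e y) (Sum.inr (Sum.inr κ))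
  rw [cfgFun_shiftCfg_inr_inr] at h
  rw [h]
  split_ifs <;> rfl

end Readback

/-! ## §3 The fundamental columns with a force source (complex-valued) -/

section Columns

variable [NeZero N]

/-- The fine field of the fundamental configuration with unit force on the bond `(l, repZ z₀)`. [folklore] -/
def gcolA (l : Fin (d + 1)) (z₀ : TorusSite (d + 1) N) : Form1 (d + 1) ℂ := cfgA (fundCfg (N := N) (srcEL l z₀))

/-- Its coarse constraint multiplier. [folklore] -/
def gcolφ (l : Fin (d + 1)) (z₀ : TorusSite (d + 1) N) : Form1 (d + 1) ℂ := cfgφ (fundCfg (N := N) (srcEL l z₀))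

/-- Its gauge multiplier. [folklore] -/
def gcolμ (l : Fin (d + 1)) (z₀ : TorusSite (d + 1) N) : Form0 (d + 1) ℂ := cfgμ (fundCfg (N := N) (srcEL l z₀))

/-- `x` is the box point `repZ z₀` of block `0` iff its block index is `0` and its residue is `z₀`. [folklore] -/
theorem eq_repZ_iff (x : AffineAveraging.Site (d + 1)) (z₀ : TorusSite (d + 1) N) :
    x = repZ z₀ ↔ quo N x = 0 ∧ Torus.proj N x = z₀ := by
  constructor
  · rintro rfl; exact ⟨quo_repZ z₀, proj_repZ z₀⟩
  · rintro ⟨hq, hp⟩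
    have hx : x = repZ (Torus.proj N x) + (N : ℤ) • quo N x := eq_repZ_add_zsmul_quo x
    rw [hp, hq, smul_zero, add_zero] at hx
    exact hx

/-- The complex DELTA FORCE at the bond `(l, x₀)`. [folklore] -/
def deltaC (l : Fin (d + 1)) (x₀ : AffineAveraging.Site (d + 1)) : Form1 (d + 1) ℂ :=
  fun κ x => if κ = l ∧ x = x₀ then 1 else 0

/-- COLUMN IDENTITY (EL): the Euler–Lagrange equation of the force column holds with the unit force at the source bond
on the right-hand side. [folklore] -/
theorem gcolA_EL (l : Fin (d + 1)) (z₀ : TorusSite (d + 1) N) :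
    curvAdj (curv (gcolA (N := N) l z₀))
      = adjContourSum N (gcolφ (N := N) l z₀) + dz (codiff₁ (dz (gcolμ (N := N) l z₀))) + deltaC l (repZ z₀) := by
  funext κ x
  have h := fundCfg_EL (N := N) (srcEL l z₀) κ x
  simp only [Pi.add_apply, deltaC]
  rw [srcEL_inl] at h
  have hδ : (if quo N x = 0 then (if κ = l ∧ Torus.proj N x = z₀ then (1 : ℂ) else 0) else 0)
      = if κ = l ∧ x = repZ z₀ then 1 else 0 := by
    have key : x = repZ z₀ ↔ quo N x = 0 ∧ Torus.proj N x = z₀ := eq_repZ_iff (N := N) x z₀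
    by_cases hq : quo N x = 0 <;> by_cases hκ : κ = l <;> by_cases hp : Torus.proj N x = z₀ <;>
      simp [hq, hκ, hp, key]
  rw [hδ] at h
  simp only [gcolA, gcolφ, gcolμ]
  linear_combination h

/-- COLUMN IDENTITY (G): the gauge quantity of the force column is block-constant. [folklore] -/
theorem gcolA_G (l : Fin (d + 1)) (z₀ : TorusSite (d + 1) N) (y : AffineAveraging.Site (d + 1))
    (z : TorusSite (d + 1) N) :
    codiff₁ (dz (codiff₁ (gcolA (N := N) l z₀))) (repZ z + (N : ℤ) • y)
      = codiff₁ (dz (codiff₁ (gcolA (N := N) l z₀))) ((N : ℤ) • y) := by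
  by_cases hz : z = 0
  · subst hz; rw [repZ_zero, zero_add]
  · have h := fundCfg_G (N := N) (srcEL l z₀) y hz
    rw [srcEL_inr_inl] at h
    simp only [ite_self] at h
    exact sub_eq_zero.1 h

/-- COLUMN IDENTITY (M): the gauge multiplier of the force column has zero block sums. [folklore] -/
theorem gcolμ_M (l : Fin (d + 1)) (z₀ : TorusSite (d + 1) N) (y : AffineAveraging.Site (d + 1)) :
    blockSum N (gcolμ (N := N) l z₀) y = 0 := by
  have h := fundCfg_M (N := N) (srcEL l z₀) y
  rw [srcEL_inr_inl] at h
  unfold gcolμ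
  simpa using h

/-- COLUMN IDENTITY (Q): the force column is a FLUCTUATION field — all its block averages vanish. [folklore] -/
theorem gcolA_Q (l κ : Fin (d + 1)) (z₀ : TorusSite (d + 1) N) (y : AffineAveraging.Site (d + 1)) :
    contourSum N (gcolA (N := N) l z₀) κ y = 0 := by
  have h := fundCfg_Q (N := N) (srcEL l z₀) κ y
  rw [srcEL_inr_inr] at h
  unfold gcolA
  simpa using h

end Columns

/-! ## §4 The real kernels and their four identities over `ℝ` -/

section Real

variable [NeZero N]

/-- `Re` is additive on complex 1-forms. [folklore] -/
theorem re1_add (A B : Form1 (d + 1) ℂ) : re1 (A + B) = re1 A + re1 B := by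
  funext κ x; simp [re1, Complex.add_re]

/-- THE REAL FLUCTUATION KERNEL (source bond `(l, repZ z₀)` in block `0`): `wΓ l z₀ κ x = Re A^{(l,z₀)}_κ(x)`. [folklore] -/
def wΓ (l : Fin (d + 1)) (z₀ : TorusSite (d + 1) N) : Form1 (d + 1) ℝ := re1 (gcolA (N := N) l z₀)

/-- The real constraint-multiplier kernel of the force column. [folklore] -/
def wΓφ (l : Fin (d + 1)) (z₀ : TorusSite (d + 1) N) : Form1 (d + 1) ℝ := re1 (gcolφ (N := N) l z₀)

/-- The real gauge-multiplier kernel of the force column. [folklore] -/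
def wΓμ (l : Fin (d + 1)) (z₀ : TorusSite (d + 1) N) : Form0 (d + 1) ℝ := re0 (gcolμ (N := N) l z₀)

/-- The real DELTA FORCE at the bond `(l, x₀)`. [folklore] -/
def delta1 (l : Fin (d + 1)) (x₀ : AffineAveraging.Site (d + 1)) : Form1 (d + 1) ℝ :=
  fun κ x => if κ = l ∧ x = x₀ then 1 else 0

/-- Entries of `delta1`. [folklore] -/
@[simp] theorem delta1_apply (l κ : Fin (d + 1)) (x₀ x : AffineAveraging.Site (d + 1)) :
    delta1 l x₀ κ x = if κ = l ∧ x = x₀ then 1 else 0 := rfl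

/-- `Re` of the complex delta force is the real one. [folklore] -/
theorem re1_deltaC (l : Fin (d + 1)) (x₀ : AffineAveraging.Site (d + 1)) : re1 (deltaC l x₀) = delta1 l x₀ := by
  funext κ x
  simp only [re1_apply, deltaC, delta1_apply]
  split_ifs <;> simp

/-- REAL KERNEL IDENTITY (EL): `d*d (wΓ) = 𝒬ᵀ (wΓφ) + d δ d (wΓμ) + δ_{(l, repZ z₀)}`. [folklore] -/
theorem wΓ_EL (l : Fin (d + 1)) (z₀ : TorusSite (d + 1) N) :
    curvAdj (curv (wΓ (N := N) l z₀))
      = contourSumAdj N (wΓφ (N := N) l z₀) + dz (codiff₁ (dz (wΓμ (N := N) l z₀))) + delta1 l (repZ z₀) := by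
  have h := congrArg re1 (gcolA_EL (N := N) l z₀)
  rw [re1_curvAdj, re2_curv, re1_add, re1_add, re1_adjContourSum, re1_dz, re0_codiff₁, re1_dz, re1_deltaC] at h
  exact h

/-- REAL KERNEL IDENTITY (G): the gauge quantity of `wΓ` is block-constant (weak gauge condition). [folklore] -/
theorem wΓ_G (l : Fin (d + 1)) (z₀ : TorusSite (d + 1) N) :
    IsBlockConst N (codiff₁ (dz (codiff₁ (wΓ (N := N) l z₀)))) := by
  intro y b hb
  have hre : ∀ x, codiff₁ (dz (codiff₁ (wΓ (N := N) l z₀))) x = (codiff₁ (dz (codiff₁ (gcolA (N := N) l z₀))) x).re := by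
    intro x
    have := congr_fun (re0_codiff₁ (dz (codiff₁ (gcolA (N := N) l z₀)))) x
    rw [re1_dz, re0_codiff₁ (gcolA (N := N) l z₀)] at this
    simpa [wΓ] using this.symm
  rw [hre, hre, toSite_eq_repZ_proj (N := N) hb, add_comm ((N : ℤ) • y), gcolA_G]

/-- REAL KERNEL IDENTITY (M): the gauge-multiplier kernel has zero block sums. [folklore] -/
theorem wΓμ_M (l : Fin (d + 1)) (z₀ : TorusSite (d + 1) N) (y : AffineAveraging.Site (d + 1)) :
    blockSum N (wΓμ (N := N) l z₀) y = 0 := by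
  have h := congrArg Complex.re (gcolμ_M (N := N) l z₀ y)
  simp only [blockSum, Complex.re_sum, Complex.zero_re] at h ⊢
  simpa [wΓμ] using h

/-- REAL KERNEL IDENTITY (Q): `wΓ` is a fluctuation field — zero block averages. [folklore] -/
theorem wΓ_Q (l κ : Fin (d + 1)) (z₀ : TorusSite (d + 1) N) (y : AffineAveraging.Site (d + 1)) :
    contourSum N (wΓ (N := N) l z₀) κ y = 0 := by
  have := congr_fun (congr_fun (re1_contourSum (N := N) (gcolA (N := N) l z₀)) κ) y
  rw [re1_apply, gcolA_Q, Complex.zero_re] at this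
  rw [wΓ, ← this]

end Real

/-! ## §5 Exponential decay (at fixed `N`) and absolutely summable second moments -/

section Decay

variable [NeZero N]

/-- EXPONENTIAL DECAY OF THE FORCE COLUMNS in the block index, uniformly in the source `(l, z₀)`, AT FIXED `N` (the rate
`δ` and constant `M` are those of `BlochFibreMatrix.invKernel_fibre_decay_l1 (N := N)` and depend on `N`; no
uniformity in `N` is claimed). [folklore] -/
theorem fundCfg_srcEL_decay :
    ∃ δ M : ℝ, 0 < δ ∧ 0 ≤ M ∧ ∀ (l : Fin (d + 1)) (z₀ : TorusSite (d + 1) N) (q : AffineAveraging.Site (d + 1))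
      (i : Idx (d + 1) N), ‖fundCfg (N := N) (srcEL l z₀) q i‖ ≤ M * Real.exp (-(δ * l1 q)) := by
  obtain ⟨δ, M, hδ, hM, h⟩ := invKernel_fibre_decay_l1 (N := N) (d := d)
  refine ⟨δ, M, hδ, hM, fun l z₀ q i => ?_⟩
  simp only [fundCfg, mulVec_srcEL]
  exact h i _ q

/-- **DECAY OF THE FLUCTUATION KERNEL** from the origin, in the cell's `Decay510` shape, uniformly in `κ` and in the
source `(l, z₀)` (a bond of block `0`), AT FIXED `N`: witnesses `δ_N = δ / N`, `C_N = M · e^{δ (d+1)}` with `(δ, M)`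
from `invKernel_fibre_decay_l1 (N := N)`; existential PER `N`, no uniformity in `N` claimed. [folklore] -/
theorem decay_wΓ : ∃ δ C : ℝ, 0 < δ ∧ 0 ≤ C ∧ ∀ (l : Fin (d + 1)) (z₀ : TorusSite (d + 1) N) (κ : Fin (d + 1)),
    Decay510 (wΓ (N := N) l z₀ κ) C δ := by
  obtain ⟨δ, M, hδ, hM, h⟩ := fundCfg_srcEL_decay (N := N) (d := d)
  have hN : (0 : ℝ) < N := by exact_mod_cast Nat.pos_of_ne_zero (NeZero.ne N)
  refine ⟨δ / N, M * Real.exp (δ * (d + 1)), div_pos hδ hN, by positivity, fun l z₀ κ z => ?_⟩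
  calc |wΓ (N := N) l z₀ κ z| ≤ ‖gcolA (N := N) l z₀ κ z‖ := Complex.abs_re_le_norm _
    _ = ‖fundCfg (N := N) (srcEL l z₀) (quo N z) (Sum.inl (κ, Torus.proj N z))‖ := rfl
    _ ≤ M * Real.exp (-(δ * l1 (quo N z))) := h l z₀ _ _
    _ ≤ M * (Real.exp (δ * (d + 1)) * Real.exp (-(δ / N) * l1 z)) :=
        mul_le_mul_of_nonneg_left (exp_quo_le (N := N) hδ z) hM
    _ = M * Real.exp (δ * (d + 1)) * Real.exp (-(δ / N) * l1 z) := by ring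

/-- **DECAY OF THE GAUGE-MULTIPLIER KERNEL**, same witnesses, AT FIXED `N`. [folklore] -/
theorem decay_wΓμ : ∃ δ C : ℝ, 0 < δ ∧ 0 ≤ C ∧ ∀ (l : Fin (d + 1)) (z₀ : TorusSite (d + 1) N),
    Decay510 (wΓμ (N := N) l z₀) C δ := by
  obtain ⟨δ, M, hδ, hM, h⟩ := fundCfg_srcEL_decay (N := N) (d := d)
  have hN : (0 : ℝ) < N := by exact_mod_cast Nat.pos_of_ne_zero (NeZero.ne N)
  refine ⟨δ / N, M * Real.exp (δ * (d + 1)), div_pos hδ hN, by positivity, fun l z₀ z => ?_⟩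
  calc |wΓμ (N := N) l z₀ z| ≤ ‖gcolμ (N := N) l z₀ z‖ := Complex.abs_re_le_norm _
    _ = ‖fundCfg (N := N) (srcEL l z₀) (quo N z) (Sum.inr (Sum.inl (Torus.proj N z)))‖ := rfl
    _ ≤ M * Real.exp (-(δ * l1 (quo N z))) := h l z₀ _ _
    _ ≤ M * (Real.exp (δ * (d + 1)) * Real.exp (-(δ / N) * l1 z)) :=
        mul_le_mul_of_nonneg_left (exp_quo_le (N := N) hδ z) hM
    _ = M * Real.exp (δ * (d + 1)) * Real.exp (-(δ / N) * l1 z) := by ring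

/-- **DECAY OF THE CONSTRAINT-MULTIPLIER KERNEL** (a coarse field: decay in the block index), AT FIXED `N`. [folklore] -/
theorem decay_wΓφ : ∃ δ C : ℝ, 0 < δ ∧ 0 ≤ C ∧ ∀ (l : Fin (d + 1)) (z₀ : TorusSite (d + 1) N) (κ : Fin (d + 1)),
    Decay510 (wΓφ (N := N) l z₀ κ) C δ := by
  obtain ⟨δ, M, hδ, hM, h⟩ := fundCfg_srcEL_decay (N := N) (d := d)
  refine ⟨δ, M, hδ, hM, fun l z₀ κ y => ?_⟩
  calc |wΓφ (N := N) l z₀ κ y| ≤ ‖gcolφ (N := N) l z₀ κ y‖ := Complex.abs_re_le_norm _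
    _ = ‖fundCfg (N := N) (srcEL l z₀) y (Sum.inr (Sum.inr κ))‖ := rfl
    _ ≤ M * Real.exp (-(δ * l1 y)) := h l z₀ _ _
    _ = M * Real.exp (-δ * l1 y) := by rw [neg_mul]

/-- The fluctuation kernel has absolutely summable second moments (in particular it is summable). [folklore] -/
theorem absMoment₂_wΓ (l : Fin (d + 1)) (z₀ : TorusSite (d + 1) N) (κ : Fin (d + 1)) :
    AbsMoment₂ (wΓ (N := N) l z₀ κ) := by
  obtain ⟨δ, C, hδ, _, h⟩ := decay_wΓ (N := N) (d := d)
  exact absMoment₂_of_decay510 hδ (h l z₀ κ)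

/-- The gauge-multiplier kernel has absolutely summable second moments. [folklore] -/
theorem absMoment₂_wΓμ (l : Fin (d + 1)) (z₀ : TorusSite (d + 1) N) : AbsMoment₂ (wΓμ (N := N) l z₀) := by
  obtain ⟨δ, C, hδ, _, h⟩ := decay_wΓμ (N := N) (d := d)
  exact absMoment₂_of_decay510 hδ (h l z₀)

/-- The constraint-multiplier kernel has absolutely summable second moments. [folklore] -/
theorem absMoment₂_wΓφ (l : Fin (d + 1)) (z₀ : TorusSite (d + 1) N) (κ : Fin (d + 1)) :
    AbsMoment₂ (wΓφ (N := N) l z₀ κ) := by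
  obtain ⟨δ, C, hδ, _, h⟩ := decay_wΓφ (N := N) (d := d)
  exact absMoment₂_of_decay510 hδ (h l z₀ κ)

end Decay

/-! ## §6 The kernel with an arbitrary source bond: block translation covariance as the definition -/

section Translate

variable [NeZero N]

/-- THE FLUCTUATION COVARIANCE KERNEL `Γ((κ, x), (l, x'))` for an ARBITRARY source bond `(l, x')`: translate the
block-`0` kernel with source residue `proj x'` by the block index `quo x'` of the source. [folklore] -/
def Gam (κ : Fin (d + 1)) (x : AffineAveraging.Site (d + 1)) (l : Fin (d + 1)) (x' : AffineAveraging.Site (d + 1)) : ℝ :=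
  wΓ (N := N) l (Torus.proj N x') κ (x - (N : ℤ) • quo N x')

/-- Its constraint multiplier (a coarse 1-form in `q`), translated by `quo x'`. [folklore] -/
def GamΦ (κ : Fin (d + 1)) (q : AffineAveraging.Site (d + 1)) (l : Fin (d + 1)) (x' : AffineAveraging.Site (d + 1)) : ℝ :=
  wΓφ (N := N) l (Torus.proj N x') κ (q - quo N x')

/-- Its gauge multiplier, translated by `N • quo x'`. [folklore] -/
def GamM (z : AffineAveraging.Site (d + 1)) (l : Fin (d + 1)) (x' : AffineAveraging.Site (d + 1)) : ℝ :=
  wΓμ (N := N) l (Torus.proj N x') (z - (N : ℤ) • quo N x')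

omit [NeZero N] in
/-- Block sums commute with block translations (shift form). [folklore] -/
theorem blockSum_shift (f : Form0 (d + 1) ℝ) (q y : AffineAveraging.Site (d + 1)) :
    blockSum N (fun z => f (z - (N : ℤ) • q)) y = blockSum N f (y - q) := by
  simp only [blockSum]
  refine Finset.sum_congr rfl (fun b _ => ?_)
  congr 1
  rw [smul_sub]
  abel

/-- KERNEL IDENTITY (EL) for an arbitrary source bond: `d*d Γ(·, (l, x')) = 𝒬ᵀ Φ + d δ d M + δ_{(l, x')}`. [folklore] -/
theorem Gam_EL (l : Fin (d + 1)) (x' : AffineAveraging.Site (d + 1)) (μ : Fin (d + 1)) (x : AffineAveraging.Site (d + 1)) :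
    curvAdj (curv (fun κ z => Gam (N := N) κ z l x')) μ x
      = contourSumAdj N (fun κ q => GamΦ (N := N) κ q l x') μ x
        + dz (codiff₁ (dz (fun z => GamM (N := N) z l x'))) μ x + (if μ = l ∧ x = x' then 1 else 0) := by
  have hEL := congr_fun (congr_fun (wΓ_EL (N := N) l (Torus.proj N x')) μ) (x - (N : ℤ) • quo N x')
  simp only [Pi.add_apply, delta1_apply] at hEL
  have e1 : curvAdj (curv (fun κ z => Gam (N := N) κ z l x')) μ x
      = curvAdj (curv (wΓ (N := N) l (Torus.proj N x'))) μ (x - (N : ℤ) • quo N x') := by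
    simp only [Gam]; exact opEL_shift _ _ μ x
  have e2 : contourSumAdj N (fun κ q => GamΦ (N := N) κ q l x') μ x
      = contourSumAdj N (wΓφ (N := N) l (Torus.proj N x')) μ (x - (N : ℤ) • quo N x') := by
    simp only [GamΦ]; exact contourSumAdj_shift _ _ μ x
  have e3 : dz (codiff₁ (dz (fun z => GamM (N := N) z l x'))) μ x
      = dz (codiff₁ (dz (wΓμ (N := N) l (Torus.proj N x')))) μ (x - (N : ℤ) • quo N x') := by
    simp only [GamM]; exact opM_shift _ _ μ x
  have e4 : (x - (N : ℤ) • quo N x' = repZ (Torus.proj N x')) ↔ x = x' := by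
    rw [sub_eq_iff_eq_add]
    rw [← eq_repZ_add_zsmul_quo (N := N) x']
  rw [e1, e2, e3, hEL]
  simp only [e4]

/-- KERNEL IDENTITY (G) for an arbitrary source bond: the gauge quantity of `Γ(·, (l, x'))` is block-constant. [folklore] -/
theorem Gam_G (l : Fin (d + 1)) (x' : AffineAveraging.Site (d + 1)) :
    IsBlockConst N (codiff₁ (dz (codiff₁ (fun κ z => Gam (N := N) κ z l x')))) := by
  intro y b hb
  have hG := wΓ_G (N := N) l (Torus.proj N x') (y - quo N x') b hb
  have e : ∀ x, codiff₁ (dz (codiff₁ (fun κ z => Gam (N := N) κ z l x'))) x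
      = codiff₁ (dz (codiff₁ (wΓ (N := N) l (Torus.proj N x')))) (x - (N : ℤ) • quo N x') := fun x => by
    simp only [Gam]; exact opG_shift _ _ x
  rw [e, e]
  rw [show (N : ℤ) • y + toSite b - (N : ℤ) • quo N x' = (N : ℤ) • (y - quo N x') + toSite b by rw [smul_sub]; abel,
    show (N : ℤ) • y - (N : ℤ) • quo N x' = (N : ℤ) • (y - quo N x') by rw [smul_sub]]
  exact hG

/-- KERNEL IDENTITY (M) for an arbitrary source bond: zero block sums of the gauge multiplier. [folklore] -/
theorem GamM_M (l : Fin (d + 1)) (x' y : AffineAveraging.Site (d + 1)) :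
    blockSum N (fun z => GamM (N := N) z l x') y = 0 := by
  simp only [GamM]
  rw [blockSum_shift (N := N) (wΓμ (N := N) l (Torus.proj N x')) (quo N x') y]
  exact wΓμ_M (N := N) l _ _

/-- KERNEL IDENTITY (Q) for an arbitrary source bond: `Γ(·, (l, x'))` is a fluctuation field. [folklore] -/
theorem Gam_Q (l : Fin (d + 1)) (x' : AffineAveraging.Site (d + 1)) (κ : Fin (d + 1)) (y : AffineAveraging.Site (d + 1)) :
    contourSum N (fun κ z => Gam (N := N) κ z l x') κ y = 0 := by
  simp only [Gam]
  rw [contourSum_shift (N := N) (wΓ (N := N) l (Torus.proj N x')) (quo N x') κ y]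
  exact wΓ_Q (N := N) l κ _ _

/-- `|a − b|₁ ≤ |a|₁ + |b|₁`. [folklore] -/
theorem l1_sub_le (a b : AffineAveraging.Site (d + 1)) : l1 (a - b) ≤ l1 a + l1 b := by
  simp only [l1, ← Finset.sum_add_distrib]
  refine Finset.sum_le_sum (fun j _ => ?_)
  simp only [Pi.sub_apply, Int.cast_sub]
  exact abs_sub _ _

/-- A box point has `ℓ¹` size at most `N (d+1)`. [folklore] -/
theorem l1_repZ_le (z : TorusSite (d + 1) N) : l1 (repZ z) ≤ (N : ℝ) * (d + 1) := by
  have hcoord : ∀ j, |(repZ z j : ℝ)| ≤ (N : ℝ) := by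
    intro j
    have h0 : (0 : ℝ) ≤ (repZ z j : ℝ) := by exact_mod_cast repZ_nonneg z j
    have h1 : ((repZ z j : ℤ) : ℝ) < (N : ℝ) := by exact_mod_cast repZ_lt z j
    rw [abs_of_nonneg h0]; exact h1.le
  calc l1 (repZ z) = ∑ j, |(repZ z j : ℝ)| := rfl
    _ ≤ ∑ _j : Fin (d + 1), (N : ℝ) := Finset.sum_le_sum fun j _ => hcoord j
    _ = (N : ℝ) * (d + 1) := by
        rw [Finset.sum_const, Finset.card_univ, Fintype.card_fin, nsmul_eq_mul]; push_cast; ring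

/-- **DECAY OF THE FLUCTUATION COVARIANCE KERNEL IN THE BOND SEPARATION**, AT FIXED `N`, uniformly in the directions and
in the source bond: `|Γ((κ, x), (l, x'))| ≤ C e^{−δ |x − x'|₁}` with `δ = δ_N`, `C = C_N e^{δ(d+1)}` (`δ_N, C_N` of
`decay_wΓ`); existential PER `N`, no uniformity in `N` claimed. [folklore] -/
theorem decay_Gam : ∃ δ C : ℝ, 0 < δ ∧ 0 ≤ C ∧ ∀ (κ : Fin (d + 1)) (x : AffineAveraging.Site (d + 1)) (l : Fin (d + 1))
    (x' : AffineAveraging.Site (d + 1)), |Gam (N := N) κ x l x'| ≤ C * Real.exp (-δ * l1 (x - x')) := by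
  obtain ⟨δ, C, hδ, hC, h⟩ := decay_wΓ (N := N) (d := d)
  refine ⟨δ, C * Real.exp (δ * ((N : ℝ) * (d + 1))), hδ, by positivity, fun κ x l x' => ?_⟩
  have hx' : x' = repZ (Torus.proj N x') + (N : ℤ) • quo N x' := eq_repZ_add_zsmul_quo x'
  have hsplit : x - x' = (x - (N : ℤ) • quo N x') - repZ (Torus.proj N x') := by
    conv_lhs => rw [hx']
    abel
  have hl1 : l1 (x - x') ≤ l1 (x - (N : ℤ) • quo N x') + (N : ℝ) * (d + 1) := by
    rw [hsplit]
    exact (l1_sub_le _ _).trans (by linarith [l1_repZ_le (N := N) (Torus.proj N x')])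
  have hdec := h l (Torus.proj N x') κ (x - (N : ℤ) • quo N x')
  calc |Gam (N := N) κ x l x'| = |wΓ (N := N) l (Torus.proj N x') κ (x - (N : ℤ) • quo N x')| := rfl
    _ ≤ C * Real.exp (-δ * l1 (x - (N : ℤ) • quo N x')) := hdec
    _ ≤ C * (Real.exp (δ * ((N : ℝ) * (d + 1))) * Real.exp (-δ * l1 (x - x'))) := by
        refine mul_le_mul_of_nonneg_left ?_ hC
        rw [← Real.exp_add]
        exact Real.exp_le_exp.2 (by nlinarith)
    _ = C * Real.exp (δ * ((N : ℝ) * (d + 1))) * Real.exp (-δ * l1 (x - x')) := by ring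

end Translate

end

end Literature.MathematicalPhysics.QuantumFieldTheory.Balaban1983to89.Beta.KKTFluctuationKernel
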